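import Literature.NumberTheory.Automorphic.GaloisConjugateCusp
import Literature.NumberTheory.Automorphic.ModularLambdaGammaTwo
import Mathlib.RingTheory.RootsOfUnity.Complex
import Mathlib.Data.Int.GCD
import HarnessLib

/-!
# Galois conjugation of modular functions, III: the action of `SL(2, ℤ)` on the conjugate roots

Third file of the analytic proof of the Galois-conjugation input of Calegari–Dimitrov–Tang,
*The unbounded denominators conjecture* (J. Amer. Math. Soc. **38** (2025), arXiv:2109.09040),
Remark 59. Let `G` be a holomorphic function on `ℍ` invariant under a normal finite-index
subgroup `Γ₀ ≤ SL(2, ℤ)`, of exponential type at every cusp, and let `T` be the finite set of its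
conjugates `G ∘ A` (`A ∈ SL(2, ℤ)`); let `σ` be a field automorphism of `ℂ` and `G'_Φ` (`Φ ∈ T`)
the conjugate root system of `GaloisConjugateCusp.exists_conjugate_roots` (expansions at `i∞`
conjugated by `σ`). **Main theorem** (`exists_galois_conjugate_functions`): for every
`A ∈ SL(2, ℤ)` and `Φ ∈ T` there is `γ ∈ Γ(2)` with `G'_Φ ∘ A = G'_{Φ ∘ (Aγ)}` — the conjugate
roots are permuted by `SL(2, ℤ)` compatibly with the `Γ(2)`-orbits of the original roots — and
the common stabiliser of the `G'_Φ` has finite index in `SL(2, ℤ)`.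

Proof. `Γ(2)` permutes the roots of each `Γ(2)`-orbit polynomial (`λ ∘ γ = λ`); `S` maps the
roots of `𝒬_O` to those of `𝒬_{O ∘ S}` because `𝒫_O(1 − X, Y) = 𝒫_{O∘S}(X, Y)`
(`orbitPolynomial_coeff_comp_one_sub`, `λ ∘ S = 1 − λ`); for the translation `T` one compares
`q`-expansions: the coefficients of `Φ ∘ T` are `ζⁿ aₙ` (`ζ = e^{2πi/L}`), so those of the
conjugate are `σ(ζ)ⁿ σ(aₙ) = ζ^{an} σ(aₙ)` with `σ(ζ) = ζᵃ`, `a` prime to `L`, whence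
`G'_{Φ∘T} = G'_Φ ∘ Tᵃ`; writing `T = T^{aa'} · (T^L)^{-q}` with `aa' = 1 + Lq` and using that
`a'` is odd finishes, and `SL(2, ℤ) = ⟨S, T⟩`. That every holomorphic root of `𝒬_O` on `ℍ` is
one of the `G'_Ψ`, `Ψ ∈ O`, is `RootContinuation.exists_eqOn_of_forall_exists_eq`.

No definitions, no named facts.

## References

* [CalegariDimitrovTang2025] arXiv:2109.09040, Remark 59.
-/

noncomputable section

open Complex Filter Topology Function Metric Set Polynomial
open UpperHalfPlane hiding I
open scoped Real Topology MatrixGroups Manifold Nat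

namespace Literature.NumberTheory.Automorphic

namespace ModularLambda

open Literature.NumberTheory.EllipticCurves.JacobiThetaNull
open Literature.Analysis.Complex.RootContinuation (exists_eqOn_of_forall_exists_eq)
open Literature.NumberTheory.ModularForms.QExpansionAlgebra
open ModularGroup Matrix.SpecialLinearGroup

/-! ### Preliminaries -/

/-- A function on `ℍ` with `f (h +ᵥ τ) = f τ` is `h`-periodic after `ofComplex`. [folklore] -/
theorem periodic_comp_ofComplex_of_vadd_eq {f : ℍ → ℂ} {h : ℝ}
    (hf : ∀ τ : ℍ, f (h +ᵥ τ) = f τ) : Periodic (f ∘ ofComplex) h := by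
  intro w
  simp only [comp_apply]
  by_cases hw : 0 < w.im
  · have hw' : 0 < (w + h).im := by simpa using hw
    have h1 : ofComplex (w + h) = h +ᵥ ofComplex w := by
      apply UpperHalfPlane.ext
      rw [coe_vadd, ofComplex_apply_of_im_pos hw', ofComplex_apply_of_im_pos hw]
      push_cast; ring
    rw [h1, hf]
  · have hw0 : w.im ≤ 0 := not_lt.mp hw
    have hw' : (w + h).im ≤ 0 := by simpa using hw0
    rw [ofComplex_apply_of_im_nonpos hw', ofComplex_apply_of_im_nonpos hw0]

/-- `τ ↦ F (g • τ)` is holomorphic on `ℍ` when `F` is (`g ∈ SL(2, ℤ)`). [folklore] -/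
theorem mdifferentiable_comp_smul {F : ℍ → ℂ} (hF : MDiff F) (g : SL(2, ℤ)) :
    MDiff fun τ : ℍ ↦ F (g • τ) := by
  have h := differentiableOn_comp_smul (UpperHalfPlane.mdifferentiable_iff.mp hF) g
  refine UpperHalfPlane.mdifferentiable_iff.mpr (h.congr fun z hz ↦ ?_)
  simp only [comp_apply, ofComplex_apply_of_im_pos hz, ofComplex_apply]

/-- **Every holomorphic root is one of the constructed roots.** If
`𝒬(λ(τ), Y) = c(τ) ∏_{Ψ ∈ O} (Y − G'_Ψ(τ))` on `ℍ` with `c ≠ 0` and holomorphic `G'_Ψ`, and `H`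
is holomorphic with `𝒬(λ(τ), H(τ)) = 0` for all `τ`, then `H = G'_Ψ` for some `Ψ ∈ O`.
[folklore] -/
theorem exists_eq_of_root {O : Finset (ℍ → ℂ)} {G' : (ℍ → ℂ) → ℍ → ℂ}
    (hG' : ∀ Ψ ∈ O, MDiff (G' Ψ)) {Q : Polynomial ℂ[X]} {c : ℍ → ℂ} (hc : ∀ τ, c τ ≠ 0)
    (hfact : ∀ τ : ℍ, Q.map (evalRingHom (modularLambda τ)) = C (c τ) * ∏ Ψ ∈ O, (X - C (G' Ψ τ)))
    {H : ℍ → ℂ} (hH : MDiff H)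
    (hroot : ∀ τ : ℍ, (Q.map (evalRingHom (modularLambda τ))).eval (H τ) = 0) :
    ∃ Ψ ∈ O, H = G' Ψ := by
  classical
  have hopen : IsOpen {z : ℂ | 0 < z.im} := isOpen_lt continuous_const Complex.continuous_im
  have hconn : IsPreconnected {z : ℂ | 0 < z.im} := (convex_halfSpace_im_gt 0).isPreconnected
  have hpt : ∀ z ∈ {z : ℂ | 0 < z.im}, ∃ Ψ : O, (H ∘ ofComplex) z = (G' Ψ ∘ ofComplex) z := by
    intro z hz
    set τ : ℍ := ⟨z, hz⟩
    have h := hroot τ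
    rw [hfact τ, eval_mul, eval_C, eval_prod, mul_eq_zero] at h
    rcases h with h | h
    · exact absurd h (hc τ)
    · rw [Finset.prod_eq_zero_iff] at h
      obtain ⟨Ψ, hΨ, hzero⟩ := h
      rw [eval_sub, eval_X, eval_C, sub_eq_zero] at hzero
      refine ⟨⟨Ψ, hΨ⟩, ?_⟩
      simp only [comp_apply, ofComplex_apply_of_im_pos hz]
      exact hzero
  haveI : Finite O := Finite.of_fintype _
  obtain ⟨Ψ, hΨ⟩ := exists_eqOn_of_forall_exists_eq (g := fun Ψ : O ↦ G' Ψ ∘ ofComplex) hopen hconn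
    (show ((UpperHalfPlane.I : ℍ) : ℂ) ∈ {z : ℂ | 0 < z.im} from UpperHalfPlane.I.im_pos)
    ((UpperHalfPlane.mdifferentiable_iff.mp hH).analyticOnNhd hopen)
    (fun Ψ ↦ (UpperHalfPlane.mdifferentiable_iff.mp (hG' Ψ Ψ.2)).analyticOnNhd hopen) hpt
  refine ⟨Ψ, Ψ.2, funext fun τ ↦ ?_⟩
  have := hΨ τ.im_pos
  simpa [comp_apply, ofComplex_apply] using this

/-- **`q`-expansion of the shift by a natural number**: the `n`-th coefficient of
`τ ↦ F(τ + a)` is `ζ^{an}` times that of `F`, `ζ = e^{2πi/H}`; and the shift is nice. [folklore] -/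
theorem qExpansion_vadd_nat_coeff {F : ℍ → ℂ} {H : ℝ} (hH : 0 < H)
    (hF : Periodic (F ∘ ofComplex) H ∧ MDiff F ∧ IsBoundedAtImInfty F) (a : ℕ) :
    (Periodic ((fun τ : ℍ ↦ F ((a : ℝ) +ᵥ τ)) ∘ ofComplex) H ∧
      MDiff (fun τ : ℍ ↦ F ((a : ℝ) +ᵥ τ)) ∧ IsBoundedAtImInfty (fun τ : ℍ ↦ F ((a : ℝ) +ᵥ τ))) ∧
    ∀ n, (qExpansion H (fun τ : ℍ ↦ F ((a : ℝ) +ᵥ τ))).coeff n =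
      cexp (2 * π * Complex.I / H) ^ (a * n) * (qExpansion H F).coeff n := by
  induction a with
  | zero =>
    have h0 : (fun τ : ℍ ↦ F (((0 : ℕ) : ℝ) +ᵥ τ)) = F := by
      funext τ; simp
    rw [h0]
    exact ⟨hF, fun n ↦ by simp⟩
  | succ a ih =>
    obtain ⟨hnice, hcoeff⟩ := ih
    have h1 : (fun τ : ℍ ↦ F (((a + 1 : ℕ) : ℝ) +ᵥ τ)) =
        fun τ : ℍ ↦ (fun τ' : ℍ ↦ F ((a : ℝ) +ᵥ τ')) ((1 : ℝ) +ᵥ τ) := by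
      funext τ
      congr 1
      rw [vadd_vadd]
      push_cast
      ring_nf
    rw [h1]
    refine ⟨nice_vadd_one hnice, fun n ↦ ?_⟩
    rw [qExpansion_vadd_one_coeff hH hnice n, hcoeff n, ← mul_assoc, ← pow_add]
    congr 2
    ring

/-! ### The main theorem -/

/-- **`SL(2, ℤ)` permutes the conjugate roots compatibly with the `Γ(2)`-orbits, and their
common stabiliser has finite index.** Hypotheses: `G` holomorphic on `ℍ`, invariant under the
normal finite-index subgroup `Γ₀`, of exponential type `k` at every cusp; `T^L ∈ Γ₀` with `L`
even; `s` nice of period `L`, nowhere zero, invariant under `τ ↦ τ + 1`, with rational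
expansion, and every `(G ∘ A) · s` bounded at `i∞`; `λ` is `L`-periodic with rational expansion;
`σ` a field automorphism of `ℂ`. Conclusion: the finite set `T` of conjugates `G ∘ A`, functions
`G'_Φ` (`Φ ∈ T`) holomorphic on `ℍ` with `G'_Φ s` nice and
`qExpansion L (G'_Φ s) = σ (qExpansion L (Φ s))`, injective in `Φ`, such that for all
`A ∈ SL(2, ℤ)`, `Φ ∈ T` there is `γ ∈ Γ(2)` with `G'_Φ ∘ A = G'_{Φ ∘ (Aγ)}`, and a finite-index
subgroup `Γ' ≤ SL(2, ℤ)` fixing every `G'_Φ`.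
[cite: CalegariDimitrovTang2025, Remark 59 (input: Galois conjugates of modular forms)] -/
theorem exists_galois_conjugate_functions
    {Γ₀ : Subgroup SL(2, ℤ)} [Γ₀.FiniteIndex] [Γ₀.Normal] {G : ℍ → ℂ} (hGd : MDiff G)
    (hGinv : ∀ γ ∈ Γ₀, ∀ z : ℍ, G (γ • z) = G z) (k : ℕ)
    (hgr : ∀ A : SL(2, ℤ), ∃ B Mb : ℝ, ∀ z : ℍ, B ≤ z.im →
      ‖G (A • z)‖ ≤ Mb * Real.exp (π * k * z.im))
    {L : ℕ} (hL1 : 1 < L) (hL2 : 2 ∣ L) (hTL : ModularGroup.T ^ L ∈ Γ₀)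
    {s : ℍ → ℂ} (hs : Periodic (s ∘ ofComplex) L ∧ MDiff s ∧ IsBoundedAtImInfty s)
    (hs0 : ∀ τ, s τ ≠ 0) (hs1 : ∀ z : ℍ, s ((1 : ℝ) +ᵥ z) = s z)
    (hsrat : ∀ n, (qExpansion L s).coeff n ∈ Set.range ((↑) : ℚ → ℂ))
    (hGs : ∀ A : SL(2, ℤ), IsBoundedAtImInfty ((fun z ↦ G (A • z)) * s))
    (hlamper : Periodic ((fun τ : ℍ ↦ modularLambda τ) ∘ ofComplex) L)
    (hlamrat : ∀ n, (qExpansion L (fun τ : ℍ ↦ modularLambda τ)).coeff n ∈ Set.range ((↑) : ℚ → ℂ))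
    (σ : ℂ ≃+* ℂ) :
    ∃ (T : Finset (ℍ → ℂ)) (G' : (ℍ → ℂ) → ℍ → ℂ) (Γ' : Subgroup SL(2, ℤ)),
      G ∈ T ∧ (∀ A : SL(2, ℤ), ∀ Φ ∈ T, (fun z ↦ Φ (A • z)) ∈ T) ∧
      (∀ Φ ∈ T, ∃ A : SL(2, ℤ), Φ = fun z ↦ G (A • z)) ∧
      (∀ Φ ∈ T, MDiff (G' Φ) ∧
        (Periodic ((G' Φ * s) ∘ ofComplex) L ∧ MDiff (G' Φ * s) ∧ IsBoundedAtImInfty (G' Φ * s)) ∧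
        qExpansion L (G' Φ * s) = PowerSeries.map (σ : ℂ →+* ℂ) (qExpansion L (Φ * s))) ∧
      (∀ Φ ∈ T, ∀ Ψ ∈ T, G' Φ = G' Ψ → Φ = Ψ) ∧
      (∀ A : SL(2, ℤ), ∀ Φ ∈ T, ∃ γ ∈ CongruenceSubgroup.Gamma 2,
        (fun z ↦ G' Φ (A • z)) = G' (fun z ↦ Φ ((A * γ) • z))) ∧
      Γ'.FiniteIndex ∧ ∀ γ ∈ Γ', ∀ Φ ∈ T, ∀ z : ℍ, G' Φ (γ • z) = G' Φ z := by
  classical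
  set G2 : Subgroup SL(2, ℤ) := CongruenceSubgroup.Gamma 2 with hG2
  have hG2n : G2.Normal := CongruenceSubgroup.Gamma_normal 2
  have hLpos : (0 : ℝ) < L := by exact_mod_cast (zero_lt_one.trans hL1)
  have hL0 : L ≠ 0 := by omega
  -- ### the finite set of conjugates and its properties
  obtain ⟨T, hTmem, hTA⟩ := exists_conjugate_finset G hGinv
  have hGT : G ∈ T := by simpa using hTA 1
  have hTne : T.Nonempty := ⟨G, hGT⟩
  have hTstab : ∀ B : SL(2, ℤ), ∀ Φ ∈ T, (fun z ↦ Φ (B • z)) ∈ T := by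
    intro B Φ hΦ
    obtain ⟨A, rfl⟩ := hTmem Φ hΦ
    have : (fun z ↦ (fun z ↦ G (A • z)) (B • z)) = fun z ↦ G ((A * B) • z) := by
      funext z; simp [mul_smul]
    rw [this]; exact hTA (A * B)
  have hTd : ∀ Φ ∈ T, MDiff Φ := by
    intro Φ hΦ
    obtain ⟨A, rfl⟩ := hTmem Φ hΦ
    exact mdifferentiable_comp_smul hGd A
  have hTgr : ∀ Φ ∈ T, ∀ g : SL(2, ℤ), ∃ B Mb : ℝ, ∀ z : ℍ, B ≤ z.im →
      ‖Φ (g • z)‖ ≤ Mb * Real.exp (π * k * z.im) := by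
    intro Φ hΦ g
    obtain ⟨A, rfl⟩ := hTmem Φ hΦ
    obtain ⟨B, Mb, h⟩ := hgr (A * g)
    exact ⟨B, Mb, fun z hz ↦ by simpa [mul_smul] using h z hz⟩
  have hTper : ∀ Φ ∈ T, Periodic (Φ ∘ ofComplex) L := by
    intro Φ hΦ
    obtain ⟨A, rfl⟩ := hTmem Φ hΦ
    refine periodic_comp_ofComplex_of_vadd_eq fun τ ↦ ?_
    have hT : ((L : ℝ) +ᵥ τ : ℍ) = ModularGroup.T ^ (L : ℤ) • τ := by
      rw [modular_T_zpow_smul]; norm_cast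
    have hconj : A * ModularGroup.T ^ (L : ℤ) * A⁻¹ ∈ Γ₀ := by
      have h1 : ModularGroup.T ^ (L : ℤ) ∈ Γ₀ := by rw [zpow_natCast]; exact hTL
      exact Subgroup.Normal.conj_mem inferInstance _ h1 A
    show G (A • ((L : ℝ) +ᵥ τ)) = G (A • τ)
    rw [hT, ← mul_smul, show A * ModularGroup.T ^ (L : ℤ) = A * ModularGroup.T ^ (L : ℤ) * A⁻¹ * A by
      rw [inv_mul_cancel_right], mul_smul, hGinv _ hconj]
  have hTbd : ∀ Φ ∈ T, IsBoundedAtImInfty (Φ * s) := by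
    intro Φ hΦ
    obtain ⟨A, rfl⟩ := hTmem Φ hΦ
    exact hGs A
  have hTnice : ∀ Φ ∈ T, Periodic ((Φ * s) ∘ ofComplex) L ∧ MDiff (Φ * s) ∧
      IsBoundedAtImInfty (Φ * s) := fun Φ hΦ ↦
    ⟨by simpa only [Pi.mul_comp] using (hTper Φ hΦ).mul hs.1, (hTd Φ hΦ).mul hs.2.1, hTbd Φ hΦ⟩
  -- ### `Γ(2)`-orbits inside `T`
  obtain ⟨orb, horb_mem⟩ : ∃ orb : (ℍ → ℂ) → Finset (ℍ → ℂ),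
      ∀ Φ Ψ, Ψ ∈ orb Φ ↔ Ψ ∈ T ∧ ∃ γ ∈ G2, Ψ = fun z ↦ Φ (γ • z) :=
    ⟨fun Φ ↦ T.filter fun Ψ ↦ ∃ γ ∈ G2, Ψ = fun z ↦ Φ (γ • z), fun Φ Ψ ↦ by
      simp only [Finset.mem_filter]⟩
  have horb_sub : ∀ Φ, orb Φ ⊆ T := fun Φ Ψ hΨ ↦ ((horb_mem Φ Ψ).mp hΨ).1
  have horb_self : ∀ Φ ∈ T, Φ ∈ orb Φ := fun Φ hΦ ↦
    (horb_mem Φ Φ).mpr ⟨hΦ, 1, one_mem _, by funext z; simp⟩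
  have horb_ne : ∀ Φ ∈ T, (orb Φ).Nonempty := fun Φ hΦ ↦ ⟨Φ, horb_self Φ hΦ⟩
  have horb_stab : ∀ Φ, ∀ γ ∈ G2, ∀ Ψ ∈ orb Φ, (fun z ↦ Ψ (γ • z)) ∈ orb Φ := by
    intro Φ γ hγ Ψ hΨ
    obtain ⟨hΨT, γ₁, hγ₁, rfl⟩ := (horb_mem Φ Ψ).mp hΨ
    refine (horb_mem Φ _).mpr ⟨hTstab γ _ hΨT, γ₁ * γ, mul_mem hγ₁ hγ, ?_⟩
    funext z; simp [mul_smul]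
  -- an element of the orbit generates the same orbit
  have horb_eq : ∀ Φ ∈ T, ∀ Ψ ∈ orb Φ, orb Ψ = orb Φ := by
    intro Φ hΦ Ψ hΨ
    obtain ⟨hΨT, γ₁, hγ₁, rfl⟩ := (horb_mem Φ Ψ).mp hΨ
    ext Ξ
    constructor
    · intro hΞ
      obtain ⟨hΞT, γ, hγ, rfl⟩ := (horb_mem (fun z ↦ Φ (γ₁ • z)) Ξ).mp hΞ
      exact (horb_mem Φ _).mpr ⟨hΞT, γ₁ * γ, mul_mem hγ₁ hγ, by funext z; simp [mul_smul]⟩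
    · intro hΞ
      obtain ⟨hΞT, γ, hγ, rfl⟩ := (horb_mem Φ Ξ).mp hΞ
      refine (horb_mem (fun z ↦ Φ (γ₁ • z)) _).mpr ⟨hTstab γ Φ hΦ, γ₁⁻¹ * γ,
        mul_mem (inv_mem hγ₁) hγ, ?_⟩
      funext z; simp [mul_smul]
  -- ### the conjugate roots on the full set `T`
  obtain ⟨Porb, hdeg, htop, -, hPorb⟩ :=
    exists_orbitPolynomial k T hTd hTgr fun γ _ Φ hΦ ↦ hTstab γ Φ hΦ
  obtain ⟨G', hG'd, hG'exp, hG'inj, hfact⟩ :=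
    exists_conjugate_roots hTne hTd hLpos hTper hs hs0 hsrat hTbd hlamper hlamrat hdeg htop hPorb σ
  -- ### the per-orbit conjugate polynomials and their complete factorization
  have hleadne : ∀ (m : ℕ) (τ : ℍ), (modularLambda τ * (1 - modularLambda τ)) ^ m ≠ 0 := fun m τ ↦
    pow_ne_zero _ (mul_ne_zero (modularLambda_ne_zero τ.im_pos)
      (sub_ne_zero.mpr (Ne.symm (modularLambda_ne_one τ.im_pos))))
  have horbpoly : ∀ Φ ∈ T, ∃ P : Polynomial ℂ[X],
      (∀ τ : ℍ, P.map (evalRingHom (modularLambda τ)) =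
        C ((modularLambda τ * (1 - modularLambda τ)) ^ (k * (orb Φ).card)) *
          ∏ Ψ ∈ orb Φ, (X - C (Ψ τ))) ∧
      ∀ τ : ℍ, (P.map (mapRingHom (σ : ℂ →+* ℂ))).map (evalRingHom (modularLambda τ)) =
        C ((modularLambda τ * (1 - modularLambda τ)) ^ (k * (orb Φ).card)) *
          ∏ Ψ ∈ orb Φ, (X - C (G' Ψ τ)) := by
    intro Φ hΦ
    have hOd : ∀ Ψ ∈ orb Φ, MDiff Ψ := fun Ψ hΨ ↦ hTd Ψ (horb_sub Φ hΨ)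
    obtain ⟨P, hPdeg, hPtop, -, hP⟩ := exists_orbitPolynomial k (orb Φ) hOd
      (fun Ψ hΨ ↦ hTgr Ψ (horb_sub Φ hΨ)) (fun γ hγ Ψ hΨ ↦ horb_stab Φ γ hγ Ψ hΨ)
    obtain ⟨G'', -, hG''exp, -, hfact''⟩ :=
      exists_conjugate_roots (horb_ne Φ hΦ) hOd hLpos (fun Ψ hΨ ↦ hTper Ψ (horb_sub Φ hΨ)) hs hs0
        hsrat (fun Ψ hΨ ↦ hTbd Ψ (horb_sub Φ hΨ)) hlamper hlamrat hPdeg hPtop hP σ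
    -- `G'' = G'` on the orbit, by the expansions
    have hGG : ∀ Ψ ∈ orb Φ, G'' Ψ = G' Ψ := by
      intro Ψ hΨ
      have hΨT := horb_sub Φ hΨ
      have h1 : G'' Ψ * s = G' Ψ * s :=
        eq_of_qExpansion_eq hLpos (hG''exp Ψ hΨ).1 (hG'exp Ψ hΨT).1
          (by rw [(hG''exp Ψ hΨ).2, (hG'exp Ψ hΨT).2])
      funext τ
      have := congrFun h1 τ
      simp only [Pi.mul_apply] at this
      exact mul_right_cancel₀ (hs0 τ) this
    refine ⟨P, hP, fun τ ↦ ?_⟩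
    rw [hfact'' τ]
    congr 1
    exact Finset.prod_congr rfl fun Ψ hΨ ↦ by rw [hGG Ψ hΨ]
  choose! Po hPo hQo using horbpoly
  -- ### (R_γ): `Γ(2)` maps `G'_Φ` into `G'(orb Φ)`
  have hRγ : ∀ γ ∈ G2, ∀ Φ ∈ T, ∃ Ψ ∈ orb Φ, (fun z ↦ G' Φ (γ • z)) = G' Ψ := by
    intro γ hγ Φ hΦ
    refine exists_eq_of_root (fun Ψ hΨ ↦ (hG'd Ψ (horb_sub Φ hΨ)))
      (fun τ ↦ hleadne _ τ) (hQo Φ hΦ) (mdifferentiable_comp_smul (hG'd Φ hΦ) γ) fun τ ↦ ?_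
    have h := congrArg (fun p : ℂ[X] ↦ p.eval (G' Φ (γ • τ))) (hQo Φ hΦ (γ • τ))
    simp only [modularLambda_smul hγ τ] at h
    rw [h, eval_mul, eval_prod, Finset.prod_eq_zero (horb_self Φ hΦ) (by simp), mul_zero]
  -- ### (R_S)
  have hS_orb : ∀ Φ ∈ T, ∀ Ψ ∈ orb Φ, (fun z ↦ Ψ (ModularGroup.S • z)) ∈
      orb (fun z ↦ Φ (ModularGroup.S • z)) := by
    intro Φ hΦ Ψ hΨ
    obtain ⟨hΨT, γ, hγ, rfl⟩ := (horb_mem Φ Ψ).mp hΨ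
    refine (horb_mem _ _).mpr ⟨hTstab _ _ hΨT, ModularGroup.S⁻¹ * γ * ModularGroup.S, ?_, ?_⟩
    · have := hG2n.conj_mem γ hγ ModularGroup.S⁻¹
      rwa [inv_inv] at this
    · funext z; simp [mul_smul]
  have hS_card : ∀ Φ ∈ T, (orb Φ).card = (orb (fun z ↦ Φ (ModularGroup.S • z))).card := by
    intro Φ hΦ
    apply le_antisymm
    · refine Finset.card_le_card_of_injOn (fun Ψ ↦ fun z ↦ Ψ (ModularGroup.S • z))
        (fun Ψ hΨ ↦ hS_orb Φ hΦ Ψ hΨ) fun Ψ _ Ψ' _ h ↦ comp_smul_injective ModularGroup.S h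
    · refine Finset.card_le_card_of_injOn (fun Ψ ↦ fun z ↦ Ψ (ModularGroup.S⁻¹ • z))
        (fun Ψ hΨ ↦ ?_) fun Ψ _ Ψ' _ h ↦ comp_smul_injective ModularGroup.S⁻¹ h
      obtain ⟨hΨT, γ, hγ, rfl⟩ := (horb_mem _ Ψ).mp hΨ
      refine (horb_mem Φ _).mpr ⟨hTstab _ _ hΨT, ModularGroup.S * γ * ModularGroup.S⁻¹,
        hG2n.conj_mem γ hγ ModularGroup.S, ?_⟩
      funext z; simp [mul_smul]
  have hRS : ∀ Φ ∈ T, ∃ Ψ ∈ orb (fun z ↦ Φ (ModularGroup.S • z)),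
      (fun z ↦ G' Φ (ModularGroup.S • z)) = G' Ψ := by
    intro Φ hΦ
    set ΦS : ℍ → ℂ := fun z ↦ Φ (ModularGroup.S • z) with hΦS
    have hΦST : ΦS ∈ T := hTstab _ Φ hΦ
    -- `𝒬_Φ(1 - X) = 𝒬_{ΦS}(X)` coefficientwise
    have hcomp : ∀ n, ((Po Φ).coeff n).comp (1 - X) = (Po ΦS).coeff n := by
      intro n
      have h := orbitPolynomial_coeff_comp_one_sub (hS_orb Φ hΦ) (hS_card Φ hΦ) (hPo Φ hΦ)
        (by rw [hS_card Φ hΦ]; exact hPo ΦS hΦST) n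
      exact h
    have hcompσ : ∀ n, (((Po Φ).coeff n).map (σ : ℂ →+* ℂ)).comp (1 - X) =
        ((Po ΦS).coeff n).map (σ : ℂ →+* ℂ) := by
      intro n
      rw [← hcomp n, Polynomial.map_comp]
      simp
    refine exists_eq_of_root (fun Ψ hΨ ↦ hG'd Ψ (horb_sub _ hΨ)) (fun τ ↦ hleadne _ τ) (hQo ΦS hΦST)
      (mdifferentiable_comp_smul (hG'd Φ hΦ) ModularGroup.S) fun τ ↦ ?_
    -- `𝒬_{ΦS}(λ τ) = 𝒬_Φ(λ(S τ))` as polynomials in `Y`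
    have hpol : ((Po ΦS).map (mapRingHom (σ : ℂ →+* ℂ))).map (evalRingHom (modularLambda τ)) =
        ((Po Φ).map (mapRingHom (σ : ℂ →+* ℂ))).map
          (evalRingHom (modularLambda ((ModularGroup.S • τ : ℍ) : ℂ))) := by
      apply Polynomial.ext
      intro n
      simp only [Polynomial.coeff_map, coe_evalRingHom, coe_mapRingHom]
      rw [modularLambda_S_smul, ← hcompσ n, eval_comp, eval_sub, eval_one, eval_X]
    rw [hpol]
    have h := congrArg (fun p : ℂ[X] ↦ p.eval (G' Φ (ModularGroup.S • τ))) (hQo Φ hΦ (ModularGroup.S • τ))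
    rw [h, eval_mul, eval_prod, Finset.prod_eq_zero (horb_self Φ hΦ) (by simp), mul_zero]
  -- ### (R_T): exact relation `G'_Φ ∘ Tᵃ = G'_{Φ ∘ T}` with `σ ζ = ζᵃ`
  set ζ : ℂ := cexp (2 * π * Complex.I / ((L : ℝ) : ℂ)) with hζ
  have hζprim : IsPrimitiveRoot ζ L := by
    rw [hζ, Complex.ofReal_natCast]
    exact Complex.isPrimitiveRoot_exp L hL0
  haveI : NeZero L := ⟨hL0⟩
  obtain ⟨a, haL, hσζ⟩ : ∃ a < L, ζ ^ a = σ ζ :=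
    hζprim.eq_pow_of_pow_eq_one (by rw [← map_pow, hζprim.pow_eq_one, map_one])
  have hacop : a.Coprime L := by
    have hprim' : IsPrimitiveRoot (σ ζ) L :=
      (IsPrimitiveRoot.map_iff_of_injective σ.injective).mpr hζprim
    rw [← hσζ] at hprim'
    exact (hζprim.pow_iff_coprime (Nat.pos_of_ne_zero hL0) a).mp hprim'
  have hs_nat : ∀ (m : ℕ) (z : ℍ), s ((m : ℝ) +ᵥ z) = s z := by
    intro m
    induction m with
    | zero => intro z; simp
    | succ m ih =>
      intro z
      have : (((m + 1 : ℕ) : ℝ) +ᵥ z : ℍ) = (1 : ℝ) +ᵥ ((m : ℝ) +ᵥ z) := by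
        rw [vadd_vadd]; push_cast; ring_nf
      rw [this, hs1, ih]
  have hRTa : ∀ Φ ∈ T, (fun z ↦ G' Φ (ModularGroup.T ^ a • z)) =
      G' (fun z ↦ Φ (ModularGroup.T • z)) := by
    intro Φ hΦ
    set ΦT : ℍ → ℂ := fun z ↦ Φ (ModularGroup.T • z) with hΦT
    have hΦTT : ΦT ∈ T := hTstab _ Φ hΦ
    -- both sides times `s` are nice; compare expansions
    have hleft : (fun z ↦ G' Φ (ModularGroup.T ^ a • z)) * s =
        fun z : ℍ ↦ (G' Φ * s) ((a : ℝ) +ᵥ z) := by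
      funext z
      simp only [Pi.mul_apply]
      rw [show ModularGroup.T ^ a • z = ((a : ℝ) +ᵥ z : ℍ) by
        rw [← zpow_natCast, modular_T_zpow_smul, Int.cast_natCast], hs_nat a z]
    obtain ⟨hnice_shift, hcoeff_shift⟩ := qExpansion_vadd_nat_coeff hLpos (hG'exp Φ hΦ).1 a
    obtain ⟨hnice_shift1, hcoeff_shift1⟩ := qExpansion_vadd_nat_coeff hLpos (hTnice Φ hΦ) 1
    have hΦTs : ΦT * s = fun z : ℍ ↦ (Φ * s) (((1 : ℕ) : ℝ) +ᵥ z) := by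
      funext z
      simp only [Pi.mul_apply, hΦT, Nat.cast_one]
      rw [modular_T_smul, ← hs1 z]
    have hexp_eq : qExpansion L ((fun z ↦ G' Φ (ModularGroup.T ^ a • z)) * s) =
        qExpansion L (G' ΦT * s) := by
      ext n
      rw [hleft, hcoeff_shift n, (hG'exp Φ hΦ).2, (hG'exp ΦT hΦTT).2, PowerSeries.coeff_map,
        PowerSeries.coeff_map, hΦTs, hcoeff_shift1 n, one_mul, map_mul, map_pow]
      congr 1
      rw [RingHom.coe_coe, ← hζ, ← hσζ, ← pow_mul]
    have heq : (fun z ↦ G' Φ (ModularGroup.T ^ a • z)) * s = G' ΦT * s := by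
      refine eq_of_qExpansion_eq hLpos ?_ (hG'exp ΦT hΦTT).1 hexp_eq
      rw [hleft]; exact hnice_shift
    funext z
    have := congrFun heq z
    simp only [Pi.mul_apply] at this
    exact mul_right_cancel₀ (hs0 z) this
  -- ### the relation `R` and its closure properties
  -- `R A : ∀ Φ ∈ T, ∃ γ ∈ Γ(2), G'_Φ ∘ A = G'_{Φ ∘ (A γ)}`
  have hR_mul : ∀ A B : SL(2, ℤ),
      (∀ Φ ∈ T, ∃ γ ∈ G2, (fun z ↦ G' Φ (A • z)) = G' (fun z ↦ Φ ((A * γ) • z))) →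
      (∀ Φ ∈ T, ∃ γ ∈ G2, (fun z ↦ G' Φ (B • z)) = G' (fun z ↦ Φ ((B * γ) • z))) →
      ∀ Φ ∈ T, ∃ γ ∈ G2, (fun z ↦ G' Φ ((A * B) • z)) = G' (fun z ↦ Φ ((A * B * γ) • z)) := by
    intro A B hA hB Φ hΦ
    obtain ⟨γ₁, hγ₁, h1⟩ := hA Φ hΦ
    have hΦ' : (fun z ↦ Φ ((A * γ₁) • z)) ∈ T := hTstab _ Φ hΦ
    obtain ⟨γ₂, hγ₂, h2⟩ := hB _ hΦ'
    refine ⟨B⁻¹ * γ₁ * B * γ₂, mul_mem (by simpa using hG2n.conj_mem γ₁ hγ₁ B⁻¹) hγ₂, ?_⟩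
    have h1' : ∀ z, G' Φ (A • z) = G' (fun z ↦ Φ ((A * γ₁) • z)) z := fun z ↦ congrFun h1 z
    funext z
    rw [mul_smul, h1', congrFun h2 z]
    congr 1
    funext w
    rw [← mul_smul]
    congr 1
    group
  have hR_of_G2 : ∀ γ ∈ G2, ∀ Φ ∈ T, ∃ γ' ∈ G2,
      (fun z ↦ G' Φ (γ • z)) = G' (fun z ↦ Φ ((γ * γ') • z)) := by
    intro γ hγ Φ hΦ
    obtain ⟨Ψ, hΨ, h⟩ := hRγ γ hγ Φ hΦ
    obtain ⟨-, γ₁, hγ₁, rfl⟩ := (horb_mem Φ Ψ).mp hΨ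
    exact ⟨γ⁻¹ * γ₁, mul_mem (inv_mem hγ) hγ₁, by rw [h]; congr 1; funext z; simp⟩
  have hR_S : ∀ Φ ∈ T, ∃ γ ∈ G2,
      (fun z ↦ G' Φ (ModularGroup.S • z)) = G' (fun z ↦ Φ ((ModularGroup.S * γ) • z)) := by
    intro Φ hΦ
    obtain ⟨Ψ, hΨ, h⟩ := hRS Φ hΦ
    obtain ⟨-, γ₁, hγ₁, rfl⟩ := (horb_mem _ Ψ).mp hΨ
    exact ⟨γ₁, hγ₁, by rw [h]; congr 1; funext z; simp [mul_smul]⟩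
  -- powers of `Tᵃ`
  have hTL2 : ∀ m : ℕ, ModularGroup.T ^ (2 * m) ∈ G2 := by
    intro m
    have h : ModularGroup.T ^ ((2 : ℤ) * (m : ℤ)) ∈ CongruenceSubgroup.Gamma 2 := by
      have := CongruenceSubgroup.ModularGroup_T_pow_mem_Gamma 2 (2 * m) (dvd_mul_right 2 _)
      exact_mod_cast this
    rw [← zpow_natCast]
    push_cast
    exact h
  have haodd : ¬ 2 ∣ a := by
    intro h2
    have := Nat.Coprime.coprime_dvd_left h2 hacop
    rw [Nat.Prime.coprime_iff_not_dvd Nat.prime_two] at this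
    exact this hL2
  have hR_Ta : ∀ Φ ∈ T, ∃ γ ∈ G2,
      (fun z ↦ G' Φ (ModularGroup.T ^ a • z)) = G' (fun z ↦ Φ ((ModularGroup.T ^ a * γ) • z)) := by
    intro Φ hΦ
    obtain ⟨m, hm⟩ : ∃ m, a = 2 * m + 1 := by
      rcases Nat.even_or_odd a with h | h
      · exact absurd (even_iff_two_dvd.mp h) haodd
      · exact h
    refine ⟨(ModularGroup.T ^ (2 * m))⁻¹, inv_mem (hTL2 m), ?_⟩
    rw [hRTa Φ hΦ]
    congr 1
    funext z
    congr 1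
    rw [hm, pow_succ, ← (Commute.self_pow ModularGroup.T (2 * m)).eq, mul_assoc, mul_inv_cancel,
      mul_one]
  have hR_pow : ∀ (X₀ : SL(2, ℤ)),
      (∀ Φ ∈ T, ∃ γ ∈ G2, (fun z ↦ G' Φ (X₀ • z)) = G' (fun z ↦ Φ ((X₀ * γ) • z))) →
      ∀ n : ℕ, ∀ Φ ∈ T, ∃ γ ∈ G2,
        (fun z ↦ G' Φ (X₀ ^ n • z)) = G' (fun z ↦ Φ ((X₀ ^ n * γ) • z)) := by
    intro X₀ hX₀ n
    induction n with
    | zero => intro Φ hΦ; exact ⟨1, one_mem _, by simp⟩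
    | succ n ih =>
      intro Φ hΦ
      have := hR_mul (X₀ ^ n) X₀ ih hX₀ Φ hΦ
      rwa [← pow_succ] at this
  -- `T = T^{a a'} (T^L)^{-q}` with `a a' = L q + 1`
  obtain ⟨a', -, ha'⟩ := Nat.exists_mul_mod_eq_one_of_coprime hacop hL1
  have hR_T : ∀ Φ ∈ T, ∃ γ ∈ G2,
      (fun z ↦ G' Φ (ModularGroup.T • z)) = G' (fun z ↦ Φ ((ModularGroup.T * γ) • z)) := by
    obtain ⟨q, haa'⟩ : ∃ q : ℕ, a * a' = L * q + 1 := ⟨a * a' / L, by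
      have := Nat.div_add_mod (a * a') L
      rw [ha'] at this
      exact this.symm⟩
    have hpow : (ModularGroup.T ^ a) ^ a' = ModularGroup.T * ModularGroup.T ^ (L * q) := by
      rw [← pow_mul, haa', pow_succ, ((Commute.self_pow ModularGroup.T (L * q))).eq]
    have hdecomp : ModularGroup.T = (ModularGroup.T ^ a) ^ a' * (ModularGroup.T ^ (L * q))⁻¹ := by
      rw [hpow, mul_inv_cancel_right]
    have hTLq : (ModularGroup.T ^ (L * q))⁻¹ ∈ G2 := by
      obtain ⟨m, hm⟩ := hL2
      refine inv_mem ?_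
      rw [hm, mul_assoc]
      exact hTL2 _
    intro Φ hΦ
    have h := hR_mul _ _ (hR_pow _ hR_Ta a') (hR_of_G2 _ hTLq) Φ hΦ
    rwa [← hdecomp] at h
  -- inverses of the generators
  have hSS : ModularGroup.S * ModularGroup.S = (-1 : SL(2, ℤ)) :=
    Subtype.ext (by
      rw [Matrix.SpecialLinearGroup.coe_mul, Matrix.SpecialLinearGroup.coe_neg,
        Matrix.SpecialLinearGroup.coe_one]
      exact ModularGroup.S_mul_S_eq)
  have hS4 : ModularGroup.S⁻¹ = ModularGroup.S * ModularGroup.S * ModularGroup.S := by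
    refine inv_eq_of_mul_eq_one_right ?_
    calc ModularGroup.S * (ModularGroup.S * ModularGroup.S * ModularGroup.S)
        = (ModularGroup.S * ModularGroup.S) * (ModularGroup.S * ModularGroup.S) := by group
      _ = 1 := by rw [hSS]; simp
  have hR_Sinv : ∀ Φ ∈ T, ∃ γ ∈ G2,
      (fun z ↦ G' Φ (ModularGroup.S⁻¹ • z)) = G' (fun z ↦ Φ ((ModularGroup.S⁻¹ * γ) • z)) := by
    rw [hS4]
    exact hR_mul _ _ (hR_mul _ _ hR_S hR_S) hR_S
  have hTLG2 : ModularGroup.T ^ L ∈ G2 := by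
    obtain ⟨m, hm⟩ := hL2
    rw [hm]; exact hTL2 m
  have hR_Tinv : ∀ Φ ∈ T, ∃ γ ∈ G2,
      (fun z ↦ G' Φ (ModularGroup.T⁻¹ • z)) = G' (fun z ↦ Φ ((ModularGroup.T⁻¹ * γ) • z)) := by
    have hdec : ModularGroup.T⁻¹ = ModularGroup.T ^ (L - 1) * (ModularGroup.T ^ L)⁻¹ := by
      rw [eq_mul_inv_iff_mul_eq, show ModularGroup.T ^ L = ModularGroup.T * ModularGroup.T ^ (L - 1) by
        rw [← pow_succ', Nat.sub_add_cancel (by omega)], inv_mul_cancel_left]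
    rw [hdec]
    exact hR_mul _ _ (hR_pow _ hR_T (L - 1)) (hR_of_G2 _ (inv_mem hTLG2))
  -- ### all of `SL(2, ℤ) = ⟨S, T⟩`
  have hR_all : ∀ A : SL(2, ℤ), ∀ Φ ∈ T, ∃ γ ∈ G2,
      (fun z ↦ G' Φ (A • z)) = G' (fun z ↦ Φ ((A * γ) • z)) := by
    intro A
    have hA : A ∈ Subgroup.closure ({ModularGroup.S, ModularGroup.T} : Set SL(2, ℤ)) := by
      rw [SpecialLinearGroup.SL2Z_generators]
      exact Subgroup.mem_top A
    induction hA using Subgroup.closure_induction'' with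
    | mem x hx =>
      rcases hx with rfl | rfl
      exacts [hR_S, hR_T]
    | inv_mem x hx =>
      rcases hx with rfl | rfl
      exacts [hR_Sinv, hR_Tinv]
    | one =>
      intro Φ hΦ
      exact ⟨1, one_mem _, by simp⟩
    | mul x y _ _ hx hy => exact hR_mul x y hx hy
  -- ### the common stabiliser
  letI : MulAction SL(2, ℤ) (ℍ → ℂ) := arrowAction
  have hsmul : ∀ (A : SL(2, ℤ)) (F : ℍ → ℂ), A • F = fun z ↦ F (A⁻¹ • z) := fun _ _ ↦ rfl
  set Γ' : Subgroup SL(2, ℤ) := ⨅ Φ : T, MulAction.stabilizer SL(2, ℤ) (G' Φ) with hΓ'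
  have hfin : ∀ Φ : T, (MulAction.stabilizer SL(2, ℤ) (G' (Φ : ℍ → ℂ))).FiniteIndex := by
    intro Φ
    have horbit : MulAction.orbit SL(2, ℤ) (G' (Φ : ℍ → ℂ)) ⊆ ↑(T.image G') := by
      rintro F ⟨A, rfl⟩
      obtain ⟨γ, -, hγ⟩ := hR_all A⁻¹ Φ Φ.2
      simp only [Finset.coe_image, Set.mem_image, Finset.mem_coe]
      refine ⟨fun z ↦ (Φ : ℍ → ℂ) ((A⁻¹ * γ) • z), hTstab _ _ Φ.2, ?_⟩
      show G' _ = A • G' Φ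
      rw [hsmul, hγ]
    have hfinite : (MulAction.orbit SL(2, ℤ) (G' (Φ : ℍ → ℂ))).Finite :=
      (Finset.finite_toSet _).subset horbit
    have hne : (MulAction.orbit SL(2, ℤ) (G' (Φ : ℍ → ℂ))).Nonempty := ⟨_, MulAction.mem_orbit_self _⟩
    refine ⟨?_⟩
    rw [MulAction.index_stabilizer]
    exact ((Set.ncard_pos hfinite).mpr hne).ne'
  have hΓ'fin : Γ'.FiniteIndex := by
    rw [hΓ']
    exact Subgroup.finiteIndex_iInf hfin
  refine ⟨T, G', Γ', hGT, hTstab, hTmem, fun Φ hΦ ↦ ⟨hG'd Φ hΦ, (hG'exp Φ hΦ).1, (hG'exp Φ hΦ).2⟩,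
    hG'inj, hR_all, hΓ'fin, fun γ hγ Φ hΦ z ↦ ?_⟩
  have hmem : γ⁻¹ ∈ MulAction.stabilizer SL(2, ℤ) (G' Φ) :=
    (Subgroup.mem_iInf.mp (show γ⁻¹ ∈ ⨅ Φ : T, MulAction.stabilizer SL(2, ℤ) (G' Φ) from
      inv_mem hγ)) (⟨Φ, hΦ⟩ : T)
  rw [MulAction.mem_stabilizer_iff, hsmul, inv_inv] at hmem
  exact congrFun hmem z

end ModularLambda

end Literature.NumberTheory.Automorphic
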